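import Summits.QuantumFields.BalabanUV.Beta.GAN24.MonotoneTorusSqueeze
import Literature.MathematicalPhysics.QuantumFieldTheory.Balaban1983to89.B5Hk163Form166

/-!
# `BalabanUV.Beta.GAN24.WhitneyRowDefectGauge` — binder row G-an2-4 ∕ (CONV-C), routes R1 ∕ R6 ∕ R7 at `U = 1`: THE GAUGE SPLIT OF ROAD P2's
# ROW DEFECT `Rco j` — inside the level-`(j+1)` effective action the canonical minimiser `harmExt_j` may be replaced by BAŁABAN's `H_{Lc^j}`
# ((1.63) = (1.103)); the squeeze, the energy distance and the curl-energy CAUCHY PROPERTY of Bałaban's minimisers under Whitney prolongation,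
# modulo the size `ρ_j` of the HONEST defect `Q_{Lc^{j+1}}·Pco·H_{Lc^j} − 1` (unit b2b-balaban-gan24-p3, gen 49; v1)

NOT IN PRINT; OUR PROOF ([folklore] finite-dimensional linear algebra over TREE objects BY NAME).  HONEST FRAMING (cell contract, verbatim): «discharging
`BetaPertH` makes Bałaban's UV stability UNCONDITIONAL — a real constructive-QFT result; it is NOT the continuum limit and NOT the Clay problem.»
HONEST DEPENDENCY (verbatim): «continuum YM on T⁴ ⇐ BetaPertH ∧ nine spine estimates (0/9 proved); BetaPertH ⇐ (D1) ∧ (D4) ∧ CAP+tail; G-an2-4 gates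
asym, D1 and NE2/3/4.»

WHY THIS FILE.  Road P2's `MonotoneTorusSqueeze` (gan24-p2 g28, p252203) closed route R1 on road P4's torus avatar MODULO ONE ESTIMATE: the size of the row
defect `Rco j = Q_{Lc^{j+1}}·PcoMat j·harmExt_j − 1` of the Whitney-prolongated CANONICAL minimiser `harmExt_j = harmExt (hform j) (sread j) (Jlift (Lc^j) M)`.
That minimiser is the one closest to the face-layer lift `Jlift`, i.e. it sits in a ROUGH gauge, and `nsq (Rco j B)` need not be small (ROUTE-AUDIT-P2 §7: «the
weak form must either use the canonical `harmExt`'s gauge component explicitly or … exploit that `E_{j+1}` kills `sread`-images of curl-free fields»).  THIS FILE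
does the latter, hypothesis-free: (i) two minimisers of the level-`j` curl energy on the fibre `Q_{Lc^j}A = B` — `harmExt_j B` and Bałaban's `H_{Lc^j}B`
(`B5Hk163Torus.HkOp`, a minimiser by `Beta.BlockEffectiveAction.curl_energy_min` + `B5Hk163Form166.HkOp_eq_Hk`) — differ by a field `z` with `hform j z = 0`,
`sread j z = 0` (Pythagoras on the fibre, `MonotoneShorted.quad_harmExt_add`); (ii) the Whitney prolongation does not raise the curl energy (`MonotoneTorusSqueeze.prol`),
so `hform (j+1) (PcoMat j z) = 0` and `effAction (j+1)` kills `sread (j+1) (PcoMat j z)` (`MonotoneShorted.shortForm_mulVec_eq_zero_of_lift`); hence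
(iii) **`effAction (j+1) (Rco j B) = effAction (j+1) δ_j(B)`** with the HONEST DEFECT `δ_j(B) := Q_{Lc^{j+1}}(PcoMat j (H_{Lc^j}B)) − B` of Bałaban's smooth
minimiser, and the squeeze ∕ energy distance of road P2 hold with `δ_j(B)` in place of `Rco j B`; (iv) the norm form: `nsq δ_j(B) ≤ ρ²·nsq B` and
`‖effAction (j+1)‖ ≤ Λ` give the value step `≤ 2Λρ·nsq B`, the energy distance `≤ 2Λρ·nsq B`, and (v) the CAUCHY PROPERTY OF BAŁABAN's MINIMISERS UNDER
WHITNEY PROLONGATION in the scaled curl energy: `scal (j+1)·curlEnergy (H_{Lc^{j+1}}B − PcoLev j (H_{Lc^j}B)) ≤ (4Λρ + 2Λρ²)·nsq B` — route R7 (iii)'s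
energy-norm LEG RATE and route R6's (CONS)-class input at `U = 1`, modulo `ρ`.  The size `ρ_j = C(d)·Lc^{−j}` of the honest defect is the companion file
`WhitneyRowDefectBound` (locality of `cstep j·PcoMat j` + b05's `n`-uniform gradient-kernel decay of `H_k`); `Λ = ‖curlBound M‖` by
`MonotoneTorusEffectiveLimit.effAction_le_curlBound`.

WHAT THIS FILE PROVES (0 sorry, 0 `def`, nothing cited; every `d`, every `Lc ≥ 1`, every read-out torus `M`, every level `j`, every datum `B`):
* §1 `sread_HkOp_mulVec`, `quad_hform_HkOp` (`⟨H_{Lc^j}B, hform j H_{Lc^j}B⟩ = ⟨B, effAction j B⟩`), **`hform_harmExt_sub_HkOp`** (`hform j (harmExt_j B − H_{Lc^j}B) = 0`),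
  `sread_harmExt_sub_HkOp`.
* §2 **`hform_succ_PcoMat_of_ker`** (`hform j z = 0 ⟹ hform (j+1) (PcoMat j z) = 0`), **`effAction_succ_sread_PcoMat_of_ker`** (`⟹ effAction (j+1) (sread (j+1) (PcoMat j z)) = 0`).
* §3 `Rco_mulVec_eq_honest_add`, **`effAction_Rco_mulVec`**, **`Rco_quad_eq`** (the gauge split inside `effAction (j+1)`, linear and quadratic).
* §4 **`effAction_squeeze_honest`**, **`effAction_energy_dist_honest`**, **`squeeze_nsq_honest`** (road P2's three ENDs with the honest defect).
* §5 **`curlEnergy_HkOp_succ_sub_PcoLev_le`** (the Cauchy property of Bałaban's minimisers under Whitney prolongation, modulo `ρ`, `Λ`).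
WHAT IT DOES NOT DO: bound `ρ_j` (companion file); anything at `U ≠ 1`; NOT (CONV-C), NOT D1, NOT `BetaPertH`, NOT continuum, NOT Clay; NEVER «G-an2-4 closed».
-/

noncomputable section

namespace Summit.QuantumFields.BalabanUV.Beta.GAN24.WhitneyRowDefectGauge

open Matrix
open scoped BigOperators ComplexOrder Matrix.Norms.L2Operator
open Literature.MathematicalPhysics.QuantumFieldTheory.Balaban1983to89
open Literature.MathematicalPhysics.QuantumFieldTheory.Balaban1983to89.B5Prop11Plancherel (Tor fine)
open Literature.MathematicalPhysics.QuantumFieldTheory.Balaban1983to89.B5Prop11Lower (nsq nsq_nonneg)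
open Literature.MathematicalPhysics.QuantumFieldTheory.Balaban1983to89.B5Block118 (QvOp)
open Literature.MathematicalPhysics.QuantumFieldTheory.Balaban1983to89.B5Hk163Torus (HkOp QvOp_HkOp_mulVec)
open Literature.MathematicalPhysics.QuantumFieldTheory.Balaban1983to89.B5Hk163Form166 (HkOp_eq_Hk)
open Literature.MathematicalPhysics.QuantumFieldTheory.Balaban1983to89.Beta.FluctuationProjection (Jlift)
open Summit.QuantumFields.BalabanUV.Beta.GAN24.MonotoneTorusTower (Lev sread hform hform_isHermitian hform_posSemidef hform_quad scal scal_nonneg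
  curlEnergy)
open Summit.QuantumFields.BalabanUV.Beta.GAN24.MonotoneTorusEffective (effAction effAction_quad_eq_Hk sread_mul_Jlift one_le_pow_Lc effAction_posSemidef
  effAction_isHermitian)
open Summit.QuantumFields.BalabanUV.Beta.GAN24.MonotoneShorted (harmExt shortForm shortForm_quad quad_harmExt_add C_harmExt_mulVec
  shortForm_mulVec_eq_zero_of_lift shortForm_posSemidef ker_pairing)
open Summit.QuantumFields.BalabanUV.Beta.GAN24.MonotoneSqueeze (rowDefect trial re_pairing_le_opNorm)
open Summit.QuantumFields.BalabanUV.Beta.GAN24.MonotoneTorusSqueeze (PcoLev PcoMat PcoMat_mulVec Rco prol effAction_squeeze effAction_energy_dist)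

variable {d : ℕ} (Lc : ℕ) [NeZero Lc] (M : Fin d → ℕ) [hM : ∀ μ, NeZero (M μ)]

/-! ## §1 Two minimisers on one fibre: `harmExt_j B − H_{Lc^j}B` is curl-free and average-free -/

/-- `Q_{Lc^j}(H_{Lc^j}B) = B` read through `sread j = QvOp (Lc^j) M` (`B5Hk163Torus.QvOp_HkOp_mulVec` BY NAME). [folklore] -/
theorem sread_HkOp_mulVec (j : ℕ) (B : Tor M × Fin d → ℂ) : sread Lc M j *ᵥ (HkOp (Lc ^ j) M *ᵥ B) = B :=
  QvOp_HkOp_mulVec (Lc ^ j) M B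

/-- **`⟨H_{Lc^j}B, hform j H_{Lc^j}B⟩ = ⟨B, effAction j B⟩`**: Bałaban's minimiser computes the effective action
(`MonotoneTorusEffective.effAction_quad_eq_Hk` + `B5Hk163Form166.HkOp_eq_Hk`, at `a = 1`). [folklore] -/
theorem quad_hform_HkOp (j : ℕ) (B : Tor M × Fin d → ℂ) :
    star (HkOp (Lc ^ j) M *ᵥ B) ⬝ᵥ (hform Lc M j *ᵥ (HkOp (Lc ^ j) M *ᵥ B)) = star B ⬝ᵥ (effAction Lc M j *ᵥ B) := by
  rw [hform_quad, effAction_quad_eq_Hk Lc M j 1 one_pos, ← HkOp_eq_Hk (Lc ^ j) (one_le_pow_Lc Lc j) M 1 one_pos]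

/-- `⟨harmExt_j B, hform j harmExt_j B⟩ = ⟨B, effAction j B⟩` (`MonotoneShorted.shortForm_quad`). [folklore] -/
theorem quad_hform_harmExt (j : ℕ) (B : Tor M × Fin d → ℂ) :
    star (harmExt (hform_isHermitian Lc M j) (sread Lc M j) (Jlift (Lc ^ j) M) *ᵥ B) ⬝ᵥ
        (hform Lc M j *ᵥ (harmExt (hform_isHermitian Lc M j) (sread Lc M j) (Jlift (Lc ^ j) M) *ᵥ B))
      = star B ⬝ᵥ (effAction Lc M j *ᵥ B) := by
  rw [effAction, shortForm_quad]

/-- `sread j (harmExt_j B − H_{Lc^j}B) = 0`: both fields lie on the fibre of `B`. [folklore] -/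
theorem sread_harmExt_sub_HkOp (j : ℕ) (B : Tor M × Fin d → ℂ) :
    sread Lc M j *ᵥ (harmExt (hform_isHermitian Lc M j) (sread Lc M j) (Jlift (Lc ^ j) M) *ᵥ B - HkOp (Lc ^ j) M *ᵥ B) = 0 := by
  rw [mulVec_sub, C_harmExt_mulVec _ (sread_mul_Jlift Lc M j), sread_HkOp_mulVec, sub_self]

/-- **TWO MINIMISERS DIFFER BY A NULL FIELD**: `hform j (harmExt_j B − H_{Lc^j}B) = 0` — Pythagoras on the fibre (`quad_harmExt_add`) gives
`⟨H B, hform H B⟩ = ⟨harmExt B, hform harmExt B⟩ + ⟨z, hform z⟩` for `z = H B − harmExt B`, both energies equal `⟨B, effAction j B⟩`, so `⟨z, hform z⟩ = 0`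
and `hform z = 0` (`PosSemidef.dotProduct_mulVec_zero_iff`). [folklore] -/
theorem hform_harmExt_sub_HkOp (j : ℕ) (B : Tor M × Fin d → ℂ) :
    hform Lc M j *ᵥ (harmExt (hform_isHermitian Lc M j) (sread Lc M j) (Jlift (Lc ^ j) M) *ᵥ B - HkOp (Lc ^ j) M *ᵥ B) = 0 := by
  set h := harmExt (hform_isHermitian Lc M j) (sread Lc M j) (Jlift (Lc ^ j) M) *ᵥ B with hh
  set A := HkOp (Lc ^ j) M *ᵥ B with hA
  have hw : sread Lc M j *ᵥ (A - h) = 0 := by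
    rw [mulVec_sub, hA, hh, sread_HkOp_mulVec, C_harmExt_mulVec _ (sread_mul_Jlift Lc M j), sub_self]
  have hpy := quad_harmExt_add (hform_posSemidef Lc M j) (sread Lc M j) (Jlift (Lc ^ j) M) B hw
  rw [← hh, show h + (A - h) = A by abel, hA, quad_hform_HkOp, hh, quad_hform_harmExt] at hpy
  have hz : star (A - h) ⬝ᵥ (hform Lc M j *ᵥ (A - h)) = 0 := by
    rw [hA, hh]; linear_combination -hpy
  have hz' := ((hform_posSemidef Lc M j).dotProduct_mulVec_zero_iff (A - h)).mp hz
  rw [show h - A = -(A - h) by abel, mulVec_neg, hz', neg_zero]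

/-! ## §2 Null fields stay invisible after Whitney prolongation and reading -/

/-- **`hform j z = 0 ⟹ hform (j+1) (PcoMat j z) = 0`**: the Whitney prolongation does not raise the (scaled) curl energy (`MonotoneTorusSqueeze.prol`),
so a null field is prolongated to a null field. [folklore] -/
theorem hform_succ_PcoMat_of_ker (j : ℕ) {z : Lev Lc M j → ℂ} (hz : hform Lc M j *ᵥ z = 0) :
    hform Lc M (j + 1) *ᵥ (PcoMat Lc M j *ᵥ z) = 0 := by
  have hle := prol Lc M j z
  rw [hz, dotProduct_zero, Complex.zero_re] at hle
  have hge : 0 ≤ (star (PcoLev Lc M j z) ⬝ᵥ (hform Lc M (j + 1) *ᵥ PcoLev Lc M j z)).re :=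
    (Complex.nonneg_iff.mp ((hform_posSemidef Lc M (j + 1)).dotProduct_mulVec_nonneg _)).1
  have hq : star (PcoLev Lc M j z) ⬝ᵥ (hform Lc M (j + 1) *ᵥ PcoLev Lc M j z) = 0 := by
    rw [hform_quad] at hle hge ⊢
    rw [Complex.ofReal_re] at hle hge
    rw [le_antisymm hle hge, Complex.ofReal_zero]
  rw [PcoMat_mulVec]
  exact ((hform_posSemidef Lc M (j + 1)).dotProduct_mulVec_zero_iff _).mp hq

/-- **`hform j z = 0 ⟹ effAction (j+1) (sread (j+1) (PcoMat j z)) = 0`**: the reading of a null field is a null vector of the shorted form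
(`MonotoneShorted.shortForm_mulVec_eq_zero_of_lift`). [folklore] -/
theorem effAction_succ_sread_PcoMat_of_ker (j : ℕ) {z : Lev Lc M j → ℂ} (hz : hform Lc M j *ᵥ z = 0) :
    effAction Lc M (j + 1) *ᵥ (sread Lc M (j + 1) *ᵥ (PcoMat Lc M j *ᵥ z)) = 0 :=
  shortForm_mulVec_eq_zero_of_lift (hform_posSemidef Lc M (j + 1)) (sread_mul_Jlift Lc M (j + 1)) rfl
    (hform_succ_PcoMat_of_ker Lc M j hz)

/-! ## §3 The gauge split of road P2's row defect inside `effAction (j+1)` -/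

/-- `Rco j B = δ_j(B) + sread (j+1) (PcoMat j (harmExt_j B − H_{Lc^j}B))` with the HONEST DEFECT `δ_j(B) = sread (j+1) (PcoMat j (H_{Lc^j}B)) − B`. [folklore] -/
theorem Rco_mulVec_eq_honest_add (j : ℕ) (B : Tor M × Fin d → ℂ) :
    Rco Lc M j *ᵥ B
      = (sread Lc M (j + 1) *ᵥ (PcoMat Lc M j *ᵥ (HkOp (Lc ^ j) M *ᵥ B)) - B)
        + sread Lc M (j + 1) *ᵥ (PcoMat Lc M j *ᵥ
            (harmExt (hform_isHermitian Lc M j) (sread Lc M j) (Jlift (Lc ^ j) M) *ᵥ B - HkOp (Lc ^ j) M *ᵥ B)) := by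
  rw [Rco, rowDefect, sub_mulVec, one_mulVec, ← mulVec_mulVec, ← mulVec_mulVec, mulVec_sub (PcoMat Lc M j), mulVec_sub (sread Lc M (j + 1))]
  abel

/-- **THE GAUGE SPLIT, LINEAR FORM**: `effAction (j+1) (Rco j B) = effAction (j+1) δ_j(B)` — inside the level-`(j+1)` effective action road P2's row defect of the
canonical minimiser IS the honest defect of Bałaban's minimiser. [folklore] -/
theorem effAction_Rco_mulVec (j : ℕ) (B : Tor M × Fin d → ℂ) :
    effAction Lc M (j + 1) *ᵥ (Rco Lc M j *ᵥ B)
      = effAction Lc M (j + 1) *ᵥ (sread Lc M (j + 1) *ᵥ (PcoMat Lc M j *ᵥ (HkOp (Lc ^ j) M *ᵥ B)) - B) := by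
  rw [Rco_mulVec_eq_honest_add, mulVec_add, effAction_succ_sread_PcoMat_of_ker Lc M j (hform_harmExt_sub_HkOp Lc M j B), add_zero]

/-- **THE GAUGE SPLIT, QUADRATIC FORM**: `⟨Rco j B, effAction (j+1) (Rco j B)⟩ = ⟨δ_j(B), effAction (j+1) δ_j(B)⟩`. [folklore] -/
theorem Rco_quad_eq (j : ℕ) (B : Tor M × Fin d → ℂ) :
    star (Rco Lc M j *ᵥ B) ⬝ᵥ (effAction Lc M (j + 1) *ᵥ (Rco Lc M j *ᵥ B))
      = star (sread Lc M (j + 1) *ᵥ (PcoMat Lc M j *ᵥ (HkOp (Lc ^ j) M *ᵥ B)) - B) ⬝ᵥ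
          (effAction Lc M (j + 1) *ᵥ (sread Lc M (j + 1) *ᵥ (PcoMat Lc M j *ᵥ (HkOp (Lc ^ j) M *ᵥ B)) - B)) := by
  rw [effAction_Rco_mulVec, Rco_mulVec_eq_honest_add, star_add, add_dotProduct,
    ker_pairing (effAction_isHermitian Lc M (j + 1))
      (effAction_succ_sread_PcoMat_of_ker Lc M j (hform_harmExt_sub_HkOp Lc M j B)), add_zero]

/-! ## §4 Road P2's three ENDs with the honest defect -/

/-- **THE SQUEEZE WITH THE HONEST DEFECT**: `0 ≤ re⟨B,(effAction (j+1) − effAction j)B⟩ ≤ −2·re⟨B, effAction (j+1) δ_j(B)⟩`,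
`δ_j(B) = Q_{Lc^{j+1}}(PcoMat j (H_{Lc^j}B)) − B` — hypothesis-free (`MonotoneTorusSqueeze.effAction_squeeze` + §3). [folklore] -/
theorem effAction_squeeze_honest (j : ℕ) (B : Tor M × Fin d → ℂ) :
    0 ≤ (star B ⬝ᵥ ((effAction Lc M (j + 1) - effAction Lc M j) *ᵥ B)).re
      ∧ (star B ⬝ᵥ ((effAction Lc M (j + 1) - effAction Lc M j) *ᵥ B)).re
          ≤ -2 * (star B ⬝ᵥ (effAction Lc M (j + 1) *ᵥ
              (sread Lc M (j + 1) *ᵥ (PcoMat Lc M j *ᵥ (HkOp (Lc ^ j) M *ᵥ B)) - B))).re := by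
  have h := effAction_squeeze Lc M j B
  rw [effAction_Rco_mulVec] at h
  exact h

/-- **THE ENERGY DISTANCE WITH THE HONEST DEFECT**: road P2's trial field is within `−2re⟨B, E_{j+1} δ_j(B)⟩ − re⟨δ_j(B), E_{j+1} δ_j(B)⟩` of the
level-`(j+1)` canonical minimiser in the `hform (j+1)` energy. [folklore] -/
theorem effAction_energy_dist_honest (j : ℕ) (B : Tor M × Fin d → ℂ) :
    (star (trial (hform_isHermitian Lc M j) (hform_isHermitian Lc M (j + 1)) (sread Lc M j) (Jlift (Lc ^ j) M) (sread Lc M (j + 1))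
              (Jlift (Lc ^ (j + 1)) M) (PcoMat Lc M j) *ᵥ B
            - harmExt (hform_isHermitian Lc M (j + 1)) (sread Lc M (j + 1)) (Jlift (Lc ^ (j + 1)) M) *ᵥ B) ⬝ᵥ
        (hform Lc M (j + 1) *ᵥ
          (trial (hform_isHermitian Lc M j) (hform_isHermitian Lc M (j + 1)) (sread Lc M j) (Jlift (Lc ^ j) M) (sread Lc M (j + 1))
              (Jlift (Lc ^ (j + 1)) M) (PcoMat Lc M j) *ᵥ B
            - harmExt (hform_isHermitian Lc M (j + 1)) (sread Lc M (j + 1)) (Jlift (Lc ^ (j + 1)) M) *ᵥ B))).re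
      ≤ -2 * (star B ⬝ᵥ (effAction Lc M (j + 1) *ᵥ (sread Lc M (j + 1) *ᵥ (PcoMat Lc M j *ᵥ (HkOp (Lc ^ j) M *ᵥ B)) - B))).re
        - (star (sread Lc M (j + 1) *ᵥ (PcoMat Lc M j *ᵥ (HkOp (Lc ^ j) M *ᵥ B)) - B) ⬝ᵥ
            (effAction Lc M (j + 1) *ᵥ (sread Lc M (j + 1) *ᵥ (PcoMat Lc M j *ᵥ (HkOp (Lc ^ j) M *ᵥ B)) - B))).re := by
  have h := effAction_energy_dist Lc M j B
  rw [Rco_quad_eq, effAction_Rco_mulVec] at h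
  exact h

/-- **NORM FORM WITH THE HONEST DEFECT**: `‖effAction (j+1)‖ ≤ Λ` and `nsq δ_j(B) ≤ ρ²·nsq B` for all `B` (`ρ ≥ 0`) ⟹
`re⟨B,(effAction (j+1) − effAction j)B⟩ ≤ 2Λρ·nsq B` AND road P2's trial field is within `2Λρ·nsq B` of the level-`(j+1)` minimiser in squared energy
(pattern of `MonotoneSqueeze.squeeze_nsq`, `re_pairing_le_opNorm` BY NAME). [folklore] -/
theorem squeeze_nsq_honest (j : ℕ) {Λ ρ : ℝ} (hΛ : ‖effAction Lc M (j + 1)‖ ≤ Λ) (hρ : 0 ≤ ρ)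
    (hδ : ∀ B : Tor M × Fin d → ℂ, nsq (sread Lc M (j + 1) *ᵥ (PcoMat Lc M j *ᵥ (HkOp (Lc ^ j) M *ᵥ B)) - B) ≤ ρ ^ 2 * nsq B)
    (B : Tor M × Fin d → ℂ) :
    (star B ⬝ᵥ ((effAction Lc M (j + 1) - effAction Lc M j) *ᵥ B)).re ≤ 2 * Λ * ρ * nsq B
      ∧ (star (trial (hform_isHermitian Lc M j) (hform_isHermitian Lc M (j + 1)) (sread Lc M j) (Jlift (Lc ^ j) M) (sread Lc M (j + 1))
                (Jlift (Lc ^ (j + 1)) M) (PcoMat Lc M j) *ᵥ B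
              - harmExt (hform_isHermitian Lc M (j + 1)) (sread Lc M (j + 1)) (Jlift (Lc ^ (j + 1)) M) *ᵥ B) ⬝ᵥ
          (hform Lc M (j + 1) *ᵥ
            (trial (hform_isHermitian Lc M j) (hform_isHermitian Lc M (j + 1)) (sread Lc M j) (Jlift (Lc ^ j) M) (sread Lc M (j + 1))
                (Jlift (Lc ^ (j + 1)) M) (PcoMat Lc M j) *ᵥ B
              - harmExt (hform_isHermitian Lc M (j + 1)) (sread Lc M (j + 1)) (Jlift (Lc ^ (j + 1)) M) *ᵥ B))).re ≤ 2 * Λ * ρ * nsq B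
      ∧ (star (sread Lc M (j + 1) *ᵥ (PcoMat Lc M j *ᵥ (HkOp (Lc ^ j) M *ᵥ B)) - B) ⬝ᵥ
            (effAction Lc M (j + 1) *ᵥ (sread Lc M (j + 1) *ᵥ (PcoMat Lc M j *ᵥ (HkOp (Lc ^ j) M *ᵥ B)) - B))).re ≤ Λ * ρ ^ 2 * nsq B := by
  set Ef := effAction Lc M (j + 1) with hEf
  set r := sread Lc M (j + 1) *ᵥ (PcoMat Lc M j *ᵥ (HkOp (Lc ^ j) M *ᵥ B)) - B with hr
  have hcs := re_pairing_le_opNorm Ef B r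
  have hcs2 := re_pairing_le_opNorm Ef r r
  have hsq : Real.sqrt (nsq r) ≤ ρ * Real.sqrt (nsq B) := by
    calc Real.sqrt (nsq r) ≤ Real.sqrt (ρ ^ 2 * nsq B) := Real.sqrt_le_sqrt (hδ B)
      _ = ρ * Real.sqrt (nsq B) := by rw [Real.sqrt_mul (sq_nonneg _), Real.sqrt_sq hρ]
  have hE0 : 0 ≤ ‖Ef‖ := norm_nonneg _
  have hΛ0 : 0 ≤ Λ := hE0.trans hΛ
  have hB0 : 0 ≤ Real.sqrt (nsq B) := Real.sqrt_nonneg _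
  have hr0 : 0 ≤ Real.sqrt (nsq r) := Real.sqrt_nonneg _
  have hBB : Real.sqrt (nsq B) * Real.sqrt (nsq B) = nsq B := Real.mul_self_sqrt (nsq_nonneg B)
  have hmain : |(star B ⬝ᵥ (Ef *ᵥ r)).re| ≤ Λ * ρ * nsq B := by
    calc |(star B ⬝ᵥ (Ef *ᵥ r)).re| ≤ ‖Ef‖ * Real.sqrt (nsq B) * Real.sqrt (nsq r) := hcs
      _ ≤ Λ * Real.sqrt (nsq B) * (ρ * Real.sqrt (nsq B)) :=
          mul_le_mul (mul_le_mul_of_nonneg_right hΛ hB0) hsq hr0 (mul_nonneg hΛ0 hB0)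
      _ = Λ * ρ * (Real.sqrt (nsq B) * Real.sqrt (nsq B)) := by ring
      _ = Λ * ρ * nsq B := by rw [hBB]
  have hmain2 : |(star r ⬝ᵥ (Ef *ᵥ r)).re| ≤ Λ * ρ ^ 2 * nsq B := by
    calc |(star r ⬝ᵥ (Ef *ᵥ r)).re| ≤ ‖Ef‖ * Real.sqrt (nsq r) * Real.sqrt (nsq r) := hcs2
      _ ≤ Λ * (ρ * Real.sqrt (nsq B)) * (ρ * Real.sqrt (nsq B)) :=
          mul_le_mul (mul_le_mul hΛ hsq hr0 hΛ0) hsq hr0 (mul_nonneg hΛ0 (mul_nonneg hρ hB0))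
      _ = Λ * ρ ^ 2 * (Real.sqrt (nsq B) * Real.sqrt (nsq B)) := by ring
      _ = Λ * ρ ^ 2 * nsq B := by rw [hBB]
  have hsq2 := (effAction_squeeze_honest Lc M j B).2
  have hed := effAction_energy_dist_honest Lc M j B
  rw [← hEf, ← hr] at hsq2 hed
  have hrr : 0 ≤ (star r ⬝ᵥ (Ef *ᵥ r)).re := (Complex.nonneg_iff.mp ((effAction_posSemidef Lc M (j + 1)).dotProduct_mulVec_nonneg r)).1
  have hab := (abs_le.mp hmain).1
  have hab2 := (abs_le.mp hmain2).2
  refine ⟨by linarith, by linarith, hab2⟩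

/-! ## §5 The Cauchy property of Bałaban's minimisers under Whitney prolongation, in the scaled curl energy (modulo `ρ`, `Λ`) -/

/-- **THE CAUCHY PROPERTY OF BAŁABAN's MINIMISERS UNDER WHITNEY PROLONGATION (modulo `ρ`, `Λ`)**: if `‖effAction (j+1)‖ ≤ Λ` and the honest defect obeys
`nsq (Q_{Lc^{j+1}}(PcoMat j (H_{Lc^j}B)) − B) ≤ ρ²·nsq B` for all `B` (`ρ ≥ 0`), then for every datum `B`
`scal (j+1)·curlEnergy (H_{Lc^{j+1}}B − PcoLev j (H_{Lc^j}B)) ≤ (4Λρ + 2Λρ²)·nsq B` — the level-`(j+1)` minimiser and the Whitney-prolongated level-`j`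
minimiser are close in the SCALED CURL ENERGY (route R7 (iii)'s energy-norm leg rate ∕ route R6's (CONS)-class input at `U = 1`, with the rate carried by `ρ`).
Mechanism: `H_{j+1}B − Pco H_jB = −[(t − h′) + harmExt_{j+1}(Rco j B)] + [(H_{j+1}B − h′) + PcoMat j (harmExt_j B − H_jB)]`, the second bracket is `hform (j+1)`-null
(§1 at level `j+1`, §2), the first is bounded by the energy distance (§4) and `⟨Rco B, E_{j+1} Rco B⟩ = ⟨δ, E_{j+1} δ⟩ ≤ Λρ²·nsq B` (§3, §4). [folklore] -/
theorem curlEnergy_HkOp_succ_sub_PcoLev_le (j : ℕ) {Λ ρ : ℝ} (hΛ : ‖effAction Lc M (j + 1)‖ ≤ Λ) (hρ : 0 ≤ ρ)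
    (hδ : ∀ B : Tor M × Fin d → ℂ, nsq (sread Lc M (j + 1) *ᵥ (PcoMat Lc M j *ᵥ (HkOp (Lc ^ j) M *ᵥ B)) - B) ≤ ρ ^ 2 * nsq B)
    (B : Tor M × Fin d → ℂ) :
    scal (d := d) Lc (j + 1) * curlEnergy (fine (Lc ^ (j + 1)) M) (HkOp (Lc ^ (j + 1)) M *ᵥ B - PcoLev Lc M j (HkOp (Lc ^ j) M *ᵥ B))
      ≤ (4 * Λ * ρ + 2 * Λ * ρ ^ 2) * nsq B := by
  obtain ⟨-, hdist, hquad⟩ := squeeze_nsq_honest Lc M j hΛ hρ hδ B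
  set H' := hform Lc M (j + 1) with hH'
  set t := trial (hform_isHermitian Lc M j) (hform_isHermitian Lc M (j + 1)) (sread Lc M j) (Jlift (Lc ^ j) M) (sread Lc M (j + 1))
      (Jlift (Lc ^ (j + 1)) M) (PcoMat Lc M j) *ᵥ B with ht
  set h' := harmExt (hform_isHermitian Lc M (j + 1)) (sread Lc M (j + 1)) (Jlift (Lc ^ (j + 1)) M) *ᵥ B with hh'
  set hj := harmExt (hform_isHermitian Lc M j) (sread Lc M j) (Jlift (Lc ^ j) M) *ᵥ B with hhj
  set A' := HkOp (Lc ^ (j + 1)) M *ᵥ B with hA'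
  set A := HkOp (Lc ^ j) M *ᵥ B with hA
  set r := Rco Lc M j *ᵥ B with hr
  -- the trial field unfolded
  have htr : t = PcoMat Lc M j *ᵥ hj - harmExt (hform_isHermitian Lc M (j + 1)) (sread Lc M (j + 1)) (Jlift (Lc ^ (j + 1)) M) *ᵥ r := by
    rw [ht, trial, sub_mulVec, ← mulVec_mulVec, ← mulVec_mulVec, ← hhj, hr, Rco]
  -- the null bracket
  have hK : H' *ᵥ ((A' - h') + PcoMat Lc M j *ᵥ (hj - A)) = 0 := by
    rw [mulVec_add, show A' - h' = -(h' - A') by abel, mulVec_neg, hH', hh', hA', hform_harmExt_sub_HkOp Lc M (j + 1) B, neg_zero, zero_add,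
      hhj, hA]
    exact hform_succ_PcoMat_of_ker Lc M j (hform_harmExt_sub_HkOp Lc M j B)
  -- the decomposition
  have hX : A' - PcoLev Lc M j A = -((t - h') + harmExt (hform_isHermitian Lc M (j + 1)) (sread Lc M (j + 1)) (Jlift (Lc ^ (j + 1)) M) *ᵥ r)
      + ((A' - h') + PcoMat Lc M j *ᵥ (hj - A)) := by
    rw [htr, ← PcoMat_mulVec, mulVec_sub]; abel
  -- quadratic forms
  have hq1 : star (A' - PcoLev Lc M j A) ⬝ᵥ (H' *ᵥ (A' - PcoLev Lc M j A))
      = star ((t - h') + harmExt (hform_isHermitian Lc M (j + 1)) (sread Lc M (j + 1)) (Jlift (Lc ^ (j + 1)) M) *ᵥ r) ⬝ᵥ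
          (H' *ᵥ ((t - h') + harmExt (hform_isHermitian Lc M (j + 1)) (sread Lc M (j + 1)) (Jlift (Lc ^ (j + 1)) M) *ᵥ r)) := by
    -- a null vector of the Hermitian form is invisible in the quadratic form (`ker_pairing`)
    have hnull : ∀ u k : Lev Lc M (j + 1) → ℂ, H' *ᵥ k = 0 → star (u + k) ⬝ᵥ (H' *ᵥ (u + k)) = star u ⬝ᵥ (H' *ᵥ u) :=
      fun u k hk => by
        rw [mulVec_add, hk, add_zero, star_add, add_dotProduct, ker_pairing (hform_isHermitian Lc M (j + 1)) hk u, add_zero]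
    rw [hX, hnull _ _ hK, mulVec_neg, star_neg, neg_dotProduct, dotProduct_neg, neg_neg]
  -- the parallelogram bound for the positive semidefinite `hform (j+1)`
  have hq2 : ∀ a b : Lev Lc M (j + 1) → ℂ,
      (star (a + b) ⬝ᵥ (H' *ᵥ (a + b))).re ≤ 2 * (star a ⬝ᵥ (H' *ᵥ a)).re + 2 * (star b ⬝ᵥ (H' *ᵥ b)).re := by
    intro a b
    have hpar : star (a + b) ⬝ᵥ (H' *ᵥ (a + b)) + star (a - b) ⬝ᵥ (H' *ᵥ (a - b))
        = 2 * (star a ⬝ᵥ (H' *ᵥ a)) + 2 * (star b ⬝ᵥ (H' *ᵥ b)) := by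
      simp only [mulVec_add, mulVec_sub, star_add, star_sub, add_dotProduct, sub_dotProduct, dotProduct_add, dotProduct_sub]
      ring
    have hre := congrArg Complex.re hpar
    simp only [Complex.add_re, Complex.mul_re, Complex.re_ofNat, Complex.im_ofNat, zero_mul, sub_zero] at hre
    have hnn : 0 ≤ (star (a - b) ⬝ᵥ (H' *ᵥ (a - b))).re :=
      (Complex.nonneg_iff.mp ((hform_posSemidef Lc M (j + 1)).dotProduct_mulVec_nonneg _)).1
    linarith
  replace hq2 := hq2 (t - h') (harmExt (hform_isHermitian Lc M (j + 1)) (sread Lc M (j + 1)) (Jlift (Lc ^ (j + 1)) M) *ᵥ r)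
  -- the energy of `harmExt_{j+1} r` is `⟨r, E_{j+1} r⟩ = ⟨δ, E_{j+1} δ⟩`
  have hq3 : star (harmExt (hform_isHermitian Lc M (j + 1)) (sread Lc M (j + 1)) (Jlift (Lc ^ (j + 1)) M) *ᵥ r) ⬝ᵥ
        (H' *ᵥ (harmExt (hform_isHermitian Lc M (j + 1)) (sread Lc M (j + 1)) (Jlift (Lc ^ (j + 1)) M) *ᵥ r))
      = star (sread Lc M (j + 1) *ᵥ (PcoMat Lc M j *ᵥ (HkOp (Lc ^ j) M *ᵥ B)) - B) ⬝ᵥ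
          (effAction Lc M (j + 1) *ᵥ (sread Lc M (j + 1) *ᵥ (PcoMat Lc M j *ᵥ (HkOp (Lc ^ j) M *ᵥ B)) - B)) := by
    rw [hH', ← shortForm_quad, hr, ← Rco_quad_eq, effAction]
  -- assemble
  have hfin : (star (A' - PcoLev Lc M j A) ⬝ᵥ (H' *ᵥ (A' - PcoLev Lc M j A))).re ≤ (4 * Λ * ρ + 2 * Λ * ρ ^ 2) * nsq B := by
    rw [hq1]
    refine hq2.trans ?_
    rw [hq3]
    rw [hA] at hquad
    linarith [hdist, hquad]
  rw [hH', hform_quad, Complex.ofReal_re] at hfin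
  exact hfin

end Summit.QuantumFields.BalabanUV.Beta.GAN24.WhitneyRowDefectGauge

end
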